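import Literature.NumberTheory.EllipticCurves.PastenValuationProductThm115Proofs
import Literature.NumberTheory.EllipticCurves.TamagawaNeZeroProofs
import Literature.NumberTheory.EllipticCurves.ComplexMultiplicationNotSemistable
import HarnessLib

/-!
# ROUTE U — `p ∤ ∏ c_ℓ` for every CM curve over `ℚ` at every prime `p ≥ 5` (the binder `htamW`)

bsd-cm cell, ROUTE U (Theorem U: BSD(49a1^{(D)}, 7) ⇒ full BSD on `𝒞₇`). The kernel theorems
`RouteU.bsdp_of_thm120_of_rem310` / `bsdp_seven_of_twist_cm7_D11` display the Tamagawa binder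
`htamW : ¬ p ∣ W.tamagawaProduct`. For a CM curve it holds at EVERY prime `p ≥ 5`: a CM curve has
no multiplicative prime (Silverman *AT* II.6.4, tree `not_mult_of_hasCM`), so at every bad place
the reduction is additive and Kodaira–Néron gives `c_ℓ ≤ 4` (tree `localTamagawaNumber_padic_le_four`,
unconditional — Tate's algorithm `index_goodReductionSubgroup_le_four_holds`), while `c_ℓ ≠ 0`
(`localTamagawaNumber_padic_ne_zero_holds`); and `Tam(W) = ∏_{bad v} c_v`
(`tamagawaProduct_eq_prod`). THEOREMS ONLY; nothing booked.

* `localTamagawaNumber_padic_le_four_of_hasCM` — `c_p(W) ≤ 4` for a CM curve, every prime `p`;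
* `not_dvd_tamagawaProduct_of_hasCM` — **`p ∤ Tam(W)` for every CM `W/ℚ` and every prime `p ≥ 5`**
  (so `htamW` of the Route-U theorems at `p = 7` for every model of every `49a1^{(D)}`).

References: [SilvermanATAEC1994] Thm. II.6.4, Cor. IV.9.2(d); [SilvermanAEC2009] VII.6;
[PastenShimura2024] proof of Cor. 16.3 (the place-by-place bookkeeping reused here).
-/

noncomputable section

open scoped Classical
open IsDedekindDomain WeierstrassCurve Rat.HeightOneSpectrum Literature.NumberTheory.EllipticCurves
open Literature.NumberTheory.EllipticCurves.Rank1Residual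

namespace Summit.BirchSwinnertonDyer.Rank1Residual.X12.O11.RouteU

/-- **`c_p ≤ 4` at every prime for a CM curve over `ℚ`**: no multiplicative (a fortiori no split
multiplicative) reduction anywhere (Silverman *AT* II.6.4), so Kodaira–Néron's bound applies
(`localTamagawaNumber_padic_le_four`). [cite: SilvermanATAEC1994, Thm. II.6.4 (PDF p. 148) and Cor. IV.9.2(d) (PDF p. 340)] -/
theorem localTamagawaNumber_padic_le_four_of_hasCM (W : WeierstrassCurve ℚ) [W.IsElliptic]
    (hCM : W.HasCM) (p : ℕ) [Fact p.Prime] :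
    (W.baseChange ℚ_[p]).localTamagawaNumber ℤ_[p] ≤ 4 :=
  localTamagawaNumber_padic_le_four p (W.baseChange ℚ_[p])
    (fun h => not_mult_of_hasCM W hCM p h.toHasMultiplicativeReduction)

/-- **`p ∤ Tam(W)` for every CM curve `W/ℚ` and every prime `p ≥ 5`** (the binder `htamW` of the
Route-U theorems): `Tam(W) = ∏_{bad v} c_v` over the finitely many bad places
(`tamagawaProduct_eq_prod`), each factor is `≤ 4 < p` (CM ⇒ no multiplicative place ⇒ Kodaira–Néron)
and non-zero (`localTamagawaNumber_padic_ne_zero_holds`).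
[cite: SilvermanATAEC1994, Thm. II.6.4 (PDF p. 148) and Cor. IV.9.2(d) (PDF p. 340)]
[cite: SilvermanAEC2009, VII.6 (the Tamagawa numbers c_v = [E(K_v) : E₀(K_v)])] -/
theorem not_dvd_tamagawaProduct_of_hasCM (W : WeierstrassCurve ℚ) [W.IsElliptic]
    (hCM : W.HasCM) (p : ℕ) (hp : p.Prime) (hp5 : 5 ≤ p) : ¬ p ∣ W.tamagawaProduct := by
  have hfin : (W.badPlaces ℤ).Finite := W.finite_badPlaces_holds ℤ
  have hs : ∀ v, ¬ W.HasGoodReductionAt v → v ∈ hfin.toFinset := fun v hv => by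
    rw [Set.Finite.mem_toFinset, mem_badPlaces_iff]
    exact hv
  rw [tamagawaProduct_eq_prod W _ hs, Prime.dvd_finsetProd_iff hp.prime]
  rintro ⟨v, -, hv⟩
  haveI := Fact.mk (primesEquiv v).2
  haveI : (W.baseChange ℚ_[primesEquiv v]).IsElliptic := by
    unfold WeierstrassCurve.baseChange; infer_instance
  have h4 := localTamagawaNumber_padic_le_four_of_hasCM W hCM (primesEquiv v : ℕ)
  have h0 : (W.baseChange ℚ_[primesEquiv v]).localTamagawaNumber ℤ_[primesEquiv v] ≠ 0 :=
    WeierstrassCurve.localTamagawaNumber_padic_ne_zero_holds (primesEquiv v : ℕ) _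
  have := Nat.le_of_dvd (Nat.pos_of_ne_zero h0) hv
  omega

end Summit.BirchSwinnertonDyer.Rank1Residual.X12.O11.RouteU

end
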